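import Literature.NumberTheory.LFunctions.Zhang2022.KnifeEdgeLenZDegreeSlotTypes

/-!
# Zhang (2022), rung F-S3 (Landau–Siegel programme, §D edge len = E*-len⁺): route `ZDegreeToeplitzBand`, item α1 —
# CONJUGATE PAIR-HOMOGENEITY: the homogeneity TYPE of the CROSS slots `X₁^ψ, X₂^ψ` as a named shape (`PairConjHomogeneous`),
# its junk-guard lemma, and the kernel shapes that realise it (`conjLeft` of the `KnifeEdgeLenZDegreeKernels` forms)

Y. Zhang, *Discrete mean estimates and the Landau–Siegel zero*, arXiv:2211.02515v1 [Zhang2022LandauSiegel] — an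
unrefereed manuscript under adjudication. **WHAT THIS IS NOT: not a claim about Theorems 1–2 of arXiv:2211.02515, about
Landau–Siegel zeros, or about Parity. The programme SEARCHES and TYPES; no claim about Landau–Siegel zeros, Theorems 1–2 of
arXiv:2211.02515 or a repaired Margin232 until a kernel theorem says so.** No table of the route is DEFINED here (item α1,
`defn-PsiGradedClosedForms`, pending the archimedean census).

WHY (`KnifeEdgeLenZDegreeSlotTypes` Part 2, PROVED there): on the (A)-recurrent horn a cross slot (`CrossTablePsi c' d X`, d = 1, 2)
pins a functional that is CONJUGATE-homogeneous in BOTH pieces (`crossTablePsi_conj_smul_left/right_of_notA_io`), while the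
α1 guard of record `KnifeEdge.PairHomogeneous` (linear in the leg-0 pair) is the type of the DUAL slot `Y₁^ψ` only — a
`PairHomogeneous` cross form is dark in class or rings the derivation alarm (`eventually_notA_of_pairHomogeneous_crossTablePsi`).
This leaf names the right shape for the cross forms and proves, exactly as `KnifeEdgeLenZDegreeMinors` Part 3 /
`KnifeEdgeLenZDegreeKernels` do for `PairHomogeneous`: `PairConjHomogeneous X` (`X(c•a,c•a′;b,b′) = conj c·X` and
`X(a,a′;c•b,c•b′) = conj c·X`) ⇒ `VanishesOnZero X` (`vanishesOnZero_of_pairConjHomogeneous`); closure under `+` and scalars;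
`conjLeft X (f,f′;g,g′) := X(conj∘f, conj∘f′; g, g′)` turns every `PairHomogeneous` shape into a `PairConjHomogeneous` one
(`pairConjHomogeneous_conjLeft`) — e.g. `conjLeft (kernelPair θ₁ θ₂ K₀₀ K₀₁ K₁₀ K₁₁ + pointPair w x₀ y₀)` =
`∫∫ (K₀₀ conj f(x)·conj g(y) + …) + w·conj f(x₀)·conj g(y₀)`, guarded (`vanishesOnZero_conjLeft_kernelPair_add_pointPair`); and the
mirror darkness check `dualCrossTablePsi_eq_zero_of_pairConjHomogeneous_of_notA_io` (a conjugate-homogeneous form on the DUAL slot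
is dark in class). So the census formulas land as one-liners with the guard for free: `X₁psi, X₂psi : PairConjHomogeneous`
(symmetric as formulas, `crossTablePsi_symm_of_notA_io`), `Y₁psi : PairHomogeneous`.

Typer: ls-knife-typer-1 (cell landau-siegel §D).

## References
* Y. Zhang, arXiv:2211.02515v1 (2022), §2 (2.16)–(2.17); §7 Prop. 7.1 (7.2); §8 (8.5). [cite: Zhang2022LandauSiegel, §2 (2.16)–(2.17), §7 Prop 7.1 (7.2), §8 (8.5)]
-/

noncomputable section

open Complex Real ComplexConjugate

namespace Literature.NumberTheory.LFunctions.Zhang2022.KnifeEdge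

open Repair Skeleton

section ConjShapes

variable {c' : ℝ} {d : ℕ} {X Y : PairFunctional}

/-- **Conjugate pair-homogeneity (shape) — the homogeneity TYPE of the cross slots:** `X(c•a, c•a′; b, b′) = conj c·X` AND
`X(a, a′; c•b, c•b′) = conj c·X`. [cite: Zhang2022LandauSiegel, §2 (2.16)–(2.17), §7 Prop 7.1 (7.2)] -/
def PairConjHomogeneous (X : PairFunctional) : Prop :=
  (∀ (c : ℂ) (a a' b b' : ℝ → ℂ), X (c • a) (c • a') b b' = conj c * X a a' b b') ∧
    ∀ (c : ℂ) (a a' b b' : ℝ → ℂ), X a a' (c • b) (c • b') = conj c * X a a' b b'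

/-- **Conjugate-homogeneous ⇒ passes the junk guard** (`c = 0` on either leg), exactly as `vanishesOnZero_of_pairHomogeneous`.
[cite: Zhang2022LandauSiegel, §7 Prop 7.1 (7.2)] -/
theorem vanishesOnZero_of_pairConjHomogeneous {X : PairFunctional} (h : PairConjHomogeneous X) : VanishesOnZero X := by
  refine ⟨fun g g' => ?_, fun f f' => ?_⟩
  · have := h.1 0 (fun _ => 0) (fun _ => 0) g g'
    simp only [zero_smul, map_zero, zero_mul] at this
    exact this
  · have := h.2 0 f f' (fun _ => 0) (fun _ => 0)
    simp only [zero_smul, map_zero, zero_mul] at this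
    exact this

/-- The zero table is conjugate pair-homogeneous. [cite: Zhang2022LandauSiegel, §7 Prop 7.1 (7.2)] -/
theorem pairConjHomogeneous_zero : PairConjHomogeneous 0 := ⟨fun _ _ _ _ _ => by simp, fun _ _ _ _ _ => by simp⟩

/-- A mutual-darkness check: a `PairConjHomogeneous` functional satisfies the DUAL slot on the (A)-recurrent horn only by vanishing
on in-class pairs (the dual slot is LINEAR in its first piece). [cite: Zhang2022LandauSiegel, §2 (2.17), §8 (8.5)] -/
theorem dualCrossTablePsi_eq_zero_of_pairConjHomogeneous_of_notA_io (hY : PairConjHomogeneous Y) (h : DualCrossTablePsi c' d Y)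
    (hA : ¬ ForAllLarge fun D _ χ => ¬ AssumptionA D χ) {g₁ g₁' g₂ g₂' : ℝ → ℂ} (hg₁ : InClassPiece g₁ g₁')
    (hg₂ : InClassPiece g₂ g₂') : Y g₁ g₁' g₂ g₂' = 0 := by
  have h1 := hY.1 I g₁ g₁' g₂ g₂'
  have h2 := dualCrossTablePsi_smul_left_of_notA_io h hA hg₁ hg₂ I
  rw [h1, Complex.conj_I] at h2
  have h3 : (2 * I) * Y g₁ g₁' g₂ g₂' = 0 := by linear_combination -h2
  exact (mul_eq_zero.mp h3).resolve_left (mul_ne_zero two_ne_zero Complex.I_ne_zero)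

/-- **Conjugation on the leg-0 pair** turns a `KnifeEdgeLenZDegreeKernels` shape into a cross-slot shape: `conjLeft X (f,f′;g,g′) := X(conj∘f, conj∘f′; g, g′)`
(e.g. `conjLeft (kernelPair θ₁ θ₂ K…) = ∫∫ (K₀₀ conj f(x)·conj g(y) + …)`). [cite: Zhang2022LandauSiegel, §7 Prop 7.1 (7.2), §8 (8.5)] -/
def conjLeft (X : PairFunctional) : PairFunctional := fun f f' g g' =>
  X (fun x => conj (f x)) (fun x => conj (f' x)) g g'

/-- `conjLeft` of a pair-homogeneous functional is conjugate pair-homogeneous. [cite: Zhang2022LandauSiegel, §7 Prop 7.1 (7.2)] -/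
theorem pairConjHomogeneous_conjLeft {X : PairFunctional} (hX : PairHomogeneous X) : PairConjHomogeneous (conjLeft X) := by
  refine ⟨fun c a a' b b' => ?_, fun c a a' b b' => ?_⟩
  · have ha : (fun x => conj ((c • a) x)) = conj c • fun x => conj (a x) := by
      funext x; simp [map_mul]
    have ha' : (fun x => conj ((c • a') x)) = conj c • fun x => conj (a' x) := by
      funext x; simp [map_mul]
    simp only [conjLeft]
    rw [ha, ha', hX.1]
  · simp only [conjLeft]
    rw [hX.2]

/-- `conjLeft` is additive (so the `PairHomogeneous` closure lemmas transfer: build a `PairHomogeneous` sum, conjugate leg 0 once).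
[cite: Zhang2022LandauSiegel, §7 Prop 7.1 (7.2)] -/
theorem conjLeft_add (X Y : PairFunctional) : conjLeft (X + Y) = conjLeft X + conjLeft Y := rfl

/-- Conjugate pair-homogeneity is preserved by sums. [cite: Zhang2022LandauSiegel, §7 Prop 7.1 (7.2)] -/
theorem PairConjHomogeneous.add {X Y : PairFunctional} (hX : PairConjHomogeneous X) (hY : PairConjHomogeneous Y) :
    PairConjHomogeneous (X + Y) := by
  refine ⟨fun c a a' b b' => ?_, fun c a a' b b' => ?_⟩
  · simp only [Pi.add_apply, hX.1, hY.1]; ring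
  · simp only [Pi.add_apply, hX.2, hY.2]; ring

/-- … and by scalar multiples. [cite: Zhang2022LandauSiegel, §7 Prop 7.1 (7.2)] -/
theorem PairConjHomogeneous.const_mul {X : PairFunctional} (hX : PairConjHomogeneous X) (w : ℂ) :
    PairConjHomogeneous (fun f f' g g' => w * X f f' g g') := by
  refine ⟨fun c a a' b b' => ?_, fun c a a' b b' => ?_⟩
  · simp only [hX.1]; ring
  · simp only [hX.2]; ring

/-- The cross-slot shapes: a conjugated kernel form (plus endpoint terms) is conjugate pair-homogeneous, hence guarded.
[cite: Zhang2022LandauSiegel, §7 Prop 7.1 (7.2), §8 (8.5)] -/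
theorem pairConjHomogeneous_conjLeft_kernelPair_add_pointPair (θ₁ θ₂ : ℝ) (K₀₀ K₀₁ K₁₀ K₁₁ : ℝ → ℝ → ℂ) (w : ℂ) (x₀ y₀ : ℝ) :
    PairConjHomogeneous (conjLeft (kernelPair θ₁ θ₂ K₀₀ K₀₁ K₁₀ K₁₁ + pointPair w x₀ y₀)) :=
  pairConjHomogeneous_conjLeft ((pairHomogeneous_kernelPair θ₁ θ₂ K₀₀ K₀₁ K₁₀ K₁₁).add (pairHomogeneous_pointPair w x₀ y₀))

/-- … so such a cross form passes the α1 junk guard. [cite: Zhang2022LandauSiegel, §7 Prop 7.1 (7.2)] -/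
theorem vanishesOnZero_conjLeft_kernelPair_add_pointPair (θ₁ θ₂ : ℝ) (K₀₀ K₀₁ K₁₀ K₁₁ : ℝ → ℝ → ℂ) (w : ℂ) (x₀ y₀ : ℝ) :
    VanishesOnZero (conjLeft (kernelPair θ₁ θ₂ K₀₀ K₀₁ K₁₀ K₁₁ + pointPair w x₀ y₀)) :=
  vanishesOnZero_of_pairConjHomogeneous (pairConjHomogeneous_conjLeft_kernelPair_add_pointPair θ₁ θ₂ K₀₀ K₀₁ K₁₀ K₁₁ w x₀ y₀)


end ConjShapes

end Literature.NumberTheory.LFunctions.Zhang2022.KnifeEdge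

end
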